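import Summits.Ventures.HSemireg.WedgeHankelFrameIntersection
import Summits.Ventures.HSemireg.WedgeHankelCoSiegelClasses

/-!
# Venture HSemireg — THE CO-SIEGEL TOWER IS GENERATED BY TH-7's CLASSES, OVER EVERY FIELD: `coSiegel(n + k′) = ⋀^{k′} ∧ coSiegel(n) = ⨆_{p ≤ k} ⋀^{k′} ∧ E_p`
# (`k + k′ = n`), dually `SI_k = ⋂_{p ≤ k} Kr(univ, E_p, k)` in EVERY degree `k ≤ n`; and `k` pure classes never cut out `SI_k` (G3 is sharp)

HONEST FRAMING. Part of the Lean index of the computation cell `pub-hsemireg` (seat p10 gen 17, Sunday typer «UNIFORM-IN-n»).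
Finite-dimensional EXTERIOR ALGEBRA over a field ONLY: no variety, no cohomology theory, no sheaf, no Ext group, no semiregularity map;
nothing here says that HC / HC_CM / HC_AV holds; no Literature fact is declared or used.  Custodian versions as in `WedgeHankelSiegelIdeal` (1/3) and
`WedgeKernelDuality`; the dictionary (`Θ^p/p! ↦ E_p = w_n(δ_p)`; `θ ↦ θ ∧ w_n(q)` ↔ `⌟v`; the co-Siegel forms = «killed by every Siegel 2-vector») is QUOTED, never asserted.

WHAT IS IN THE TREE.  Gen 11's SPIKE TEST `mem_siegelIdeal_iff_forall_spike_le` (`θ ∈ SI_k ⟺ θ ∧ E_p = 0` for `p ≤ k`, every `k ≤ n`, every field) and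
`iInf_ker_wedge_w_eq_siegelIdeal` (the intersection over ALL classes, stated under `2k ≤ n`); F4 (`coSiegel`, `Ann_siegelIdeal`), F9 (`coSiegel(n) = span{w_n(q)}`,
`w_mem_coSiegel`), G3 `WedgeHankelFrameIntersection` (this seat: `k + 1` distinct frames cut out `SI_k` in every degree; `V_w_le_coSiegel`, `Ann_iSup_V_w_eq_iInf_Kr`,
`V_univ_zero`).  G3/G4/G5 need `k + 1` DISTINCT slopes resp. named node kernels with `k + P ≤ n` — over a small field in high degree there are not enough of them.  THIS FILE
records the FIELD-INDEPENDENT statements (namespace `Summit.Ventures.HSemireg.Wedge.KernelDuality` continued; imports G3, F9):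
* §97 **`siegelIdeal_eq_iInf_Kr_w_spike`: `SI_k = ⋂_{p ≤ k} Kr(univ, E_p, k)` for every `k ≤ n`** (the spike test in `Kr` form: the `k + 1` powers `Θ^p/p!`, `p ≤ k`, cut out the
  Siegel ideal — the node `0` with multiplicity `k + 1`, with NO condition `k + P ≤ n`), **`siegelIdeal_eq_iInf_Kr_w`: `SI_k = ⋂_q Kr(univ, w_n(q), k)`** (gen 11 without `2k ≤ n`).
* §98 the dual: **`coSiegel_eq_iSup_V_w_spike`: `coSiegel(k′ + n) = ⨆_{p ≤ k} V(univ, E_p, k′)`** and **`coSiegel_eq_iSup_V_w`: `= ⨆_q V(univ, w_n(q), k′)`** (`k + k′ = n`; E1 duality +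
  dimensions).
* §99 **THE TOWER IS GENERATED IN DEGREE `n`: `Hom_mul_coSiegel_n`: `Hom(univ, k′) * coSiegel(n) = coSiegel(k′ + n)`** (submodule product in `⋀(K^{2n})`): every form killed by all
  Siegel 2-vectors is a sum of `(k′-form) ∧ (class)` — with F9, of `(k′-form) ∧ w_n(q)`; `mul_mem_coSiegel` (the co-Siegel tower is an ideal), `coSiegel_eq_bot_iff`-type count
  `finrank_coSiegel_pos`.
* §100 **G3 IS SHARP: `siegelIdeal_lt_iInf_Kr_w_exp`** — for `0 < r ≤ k ≤ n` pure classes `A_i λ_i^•` (any slopes) the intersection of their kernels is STRICTLY bigger than `SI_k`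
  (it is `Ann_k` of a sum of `r` images of dimension `C(n,k)` each, so its codimension is `≤ r·C(n,k) < (k+1)·C(n,k)`).
NOT typed here: anything Ext-side.  Class side only; new names only.
-/

open Module

namespace Summit.Ventures.HSemireg.Wedge.KernelDuality

open Summit.Ventures.HSemireg.Wedge Summit.Ventures.HSemireg.Wedge.Kunneth Summit.Ventures.HSemireg.Wedge.Hankel
  Summit.Ventures.HSemireg.Wedge.HankelSiegel Summit.Ventures.HSemireg.Wedge.HankelSiegelIdeal Summit.Ventures.HSemireg.Wedge.KunnethKernel
  Summit.Ventures.HSemireg.Wedge.HankelSecant Summit.Ventures.HSemireg.Wedge.HankelFrameChange Summit.Ventures.HSemireg.Wedge.HankelPureKernel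

variable (K : Type*) [Field K] {n : ℕ}

/-! ## §97. The Siegel ideal is cut out by the `k + 1` powers `E_0, …, E_k`, over every field -/

/-- **`SI_k = ⋂_{p ≤ k} Kr(univ, E_p, k)` for every `k ≤ n`** — gen 11's spike test in `Kr` form: a degree-`k` form is isotropic iff it kills the powers `Θ^p/p!`, `p ≤ k`
(the node `0` counted `k + 1` times; every field, no slope needed). -/
theorem siegelIdeal_eq_iInf_Kr_w_spike {k : ℕ} (hk : k ≤ n) :
    siegelIdeal K n k = ⨅ p : Fin (k + 1), Kr K Finset.univ (w K n n (fun j => if j = (p : ℕ) then (1 : K) else 0)) k := by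
  refine le_antisymm (le_iInf fun p => siegelIdeal_le_Kr_w K n k _) fun θ hθ => ?_
  rw [Submodule.mem_iInf] at hθ
  have hθk : θ ∈ ⋀[K]^k (In n → K) := by
    have := (mem_Kr.mp (hθ 0)).1; rwa [Hom_univ_eq_exteriorPower] at this
  exact (mem_siegelIdeal_iff_forall_spike_le K hk hθk).mpr fun p hp => (mem_Kr.mp (hθ ⟨p, Nat.lt_succ_of_le hp⟩)).2

/-- **`SI_k = ⋂_q Kr(univ, w_n(q), k)` for every `k ≤ n`**: the Siegel ideal is exactly what EVERY `K[Θ]`-class kills (gen 11's `iInf_ker_wedge_w_eq_siegelIdeal` carried `2k ≤ n`). -/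
theorem siegelIdeal_eq_iInf_Kr_w {k : ℕ} (hk : k ≤ n) : siegelIdeal K n k = ⨅ q : ℕ → K, Kr K Finset.univ (w K n n q) k := by
  refine le_antisymm (le_iInf fun q => siegelIdeal_le_Kr_w K n k q) ?_
  rw [siegelIdeal_eq_iInf_Kr_w_spike K hk]
  exact le_iInf fun p => iInf_le _ _

/-! ## §98. The dual: the co-Siegel space is the sum of the images of the powers / of all classes -/

/-- the annihilator of the sum of ALL images is the intersection of ALL kernels (E1; any index type). -/
lemma Ann_iSup_V_w_eq_iInf_Kr_all {k k' : ℕ} (hkk' : k + k' = n) :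
    Ann K k (⨆ q : ℕ → K, V K (In n) Finset.univ (w K n n q) k') = ⨅ q : ℕ → K, Kr K Finset.univ (w K n n q) k := by
  ext θ
  rw [mem_Ann_iSup_iff, Submodule.mem_iInf]
  constructor
  · rintro ⟨hθk, h⟩ q
    rw [Kr_w_eq_Ann K hkk']
    exact mem_Ann.mpr ⟨hθk, h q⟩
  · intro h
    have h0 := h 0
    rw [Kr_w_eq_Ann K hkk'] at h0
    refine ⟨(mem_Ann.mp h0).1, fun q v hv => ?_⟩
    have hq := h q
    rw [Kr_w_eq_Ann K hkk'] at hq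
    exact (mem_Ann.mp hq).2 v hv

/-- from `Ann_k(W) = SI_k` and `W ≤ coSiegel(k′+n)` to `W = coSiegel(k′+n)` (the perfect pairing: both have dimension `(k+1)·C(n,k)`). -/
lemma eq_coSiegel_of_Ann_eq_siegelIdeal {k k' : ℕ} (hkk' : k + k' = n) {W : Submodule K (HT K (In n))} (hle : W ≤ coSiegel K n (k' + n))
    (hAnn : Ann K k W = siegelIdeal K n k) : W = coSiegel K n (k' + n) := by
  refine Submodule.eq_of_le_of_finrank_eq hle ?_
  have h1 := finrank_Ann_add K (a := k) (b := k' + n) (I := In n) (by rw [Fintype.card_fin]; omega) (hle.trans (coSiegel_le_Hom K (k' + n)))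
  rw [hAnn, Fintype.card_fin] at h1
  have h2 := finrank_siegelIdeal K (n := n) k
  rw [finrank_coSiegel K (show k + (k' + n) = n + n by omega)]
  omega

/-- **`coSiegel(k′ + n) = ⨆_{p ≤ k} V(univ, E_p, k′)`** (`k + k′ = n`): every co-Siegel form of degree `n + k′` is a sum `Σ_{p ≤ k} θ_p ∧ E_p`, `θ_p ∈ ⋀^{k′}` — over EVERY field. -/
theorem coSiegel_eq_iSup_V_w_spike {k k' : ℕ} (hkk' : k + k' = n) :
    coSiegel K n (k' + n) = ⨆ p : Fin (k + 1), V K (In n) Finset.univ (w K n n (fun j => if j = (p : ℕ) then (1 : K) else 0)) k' := by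
  symm
  refine eq_coSiegel_of_Ann_eq_siegelIdeal K hkk' (iSup_le fun p => V_w_le_coSiegel K hkk' _) ?_
  rw [Ann_iSup_V_w_eq_iInf_Kr K hkk' (Nat.succ_pos k), ← siegelIdeal_eq_iInf_Kr_w_spike K (by omega)]

/-- **`coSiegel(k′ + n) = ⨆_q V(univ, w_n(q), k′)`** (`k + k′ = n`): the co-Siegel forms are exactly the sums of forms `θ ∧ w_n(q)`, `θ ∈ ⋀^{k′}`. -/
theorem coSiegel_eq_iSup_V_w {k k' : ℕ} (hkk' : k + k' = n) : coSiegel K n (k' + n) = ⨆ q : ℕ → K, V K (In n) Finset.univ (w K n n q) k' := by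
  symm
  refine eq_coSiegel_of_Ann_eq_siegelIdeal K hkk' (iSup_le fun q => V_w_le_coSiegel K hkk' q) ?_
  rw [Ann_iSup_V_w_eq_iInf_Kr_all K hkk', ← siegelIdeal_eq_iInf_Kr_w K (by omega)]

/-! ## §99. The co-Siegel tower is generated in degree `n` -/

/-- **THE CO-SIEGEL TOWER IS AN IDEAL**: `η ∈ Hom(univ, d)`, `θ ∈ coSiegel(j)` ⇒ `η ∧ θ ∈ coSiegel(d + j)` (the Siegel 2-vectors are killed on the right). -/
theorem mul_mem_coSiegel {d j : ℕ} {η θ : HT K (In n)} (hη : η ∈ Hom K (In n) Finset.univ d) (hθ : θ ∈ coSiegel K n j) : η * θ ∈ coSiegel K n (d + j) := by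
  obtain ⟨hθj, h0⟩ := mem_coSiegel.mp hθ
  exact mem_coSiegel.mpr ⟨Wedge.mul_mem_Hom K hη hθj, fun p => by rw [mul_assoc, h0 p, mul_zero]⟩

/-- the image of a class is `⋀^{k′} ∧ (the class)`: `V(univ, w_n(q), k′) ≤ Hom(univ, k′) * coSiegel(n)` (F9: every class is a co-Siegel `n`-form). -/
lemma V_w_le_Hom_mul_coSiegel_n (q : ℕ → K) (k' : ℕ) : V K (In n) Finset.univ (w K n n q) k' ≤ Hom K (In n) Finset.univ k' * coSiegel K n n := by
  rw [V]
  refine Submodule.span_le.mpr ?_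
  rintro _ ⟨s, ⟨-, hs⟩, rfl⟩
  exact Submodule.mul_mem_mul (B_mem_Hom K (Finset.subset_univ s) hs) (w_mem_coSiegel K q)

/-- **THE CO-SIEGEL TOWER IS GENERATED IN DEGREE `n`: `Hom(univ, k′) * coSiegel(n) = coSiegel(k′ + n)`** for every `k′ ≤ n` — every form of degree `n + k′` killed by all Siegel
2-vectors is a sum of products `(k′-form) ∧ (co-Siegel n-form)`, i.e. (F9) of `(k′-form) ∧ w_n(q)`; over EVERY field. -/
theorem Hom_mul_coSiegel_n {k' : ℕ} (hk' : k' ≤ n) : Hom K (In n) Finset.univ k' * coSiegel K n n = coSiegel K n (k' + n) := by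
  refine le_antisymm (Submodule.mul_le.mpr fun η hη θ hθ => mul_mem_coSiegel K hη hθ) ?_
  rw [coSiegel_eq_iSup_V_w K (k := n - k') (by omega)]
  exact iSup_le fun q => V_w_le_Hom_mul_coSiegel_n K q k'

/-- beyond the top degree the tower vanishes: `coSiegel(j) = ⊥` for `j > 2n`, and it is non-zero exactly in the degrees `n ≤ j ≤ 2n` (`dim = (2n − j + 1)·C(n, 2n − j)`). -/
theorem finrank_coSiegel_pos {j : ℕ} (hnj : n ≤ j) (hj : j ≤ n + n) : 0 < finrank K (coSiegel K n j) := by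
  rw [finrank_coSiegel K (k := n + n - j) (by omega)]
  exact Nat.mul_pos (Nat.succ_pos _) (Nat.choose_pos (by omega))

/-- `coSiegel(j) = ⊥` for `j > 2n` (no forms of that degree). -/
theorem coSiegel_eq_bot_of_gt {j : ℕ} (hj : n + n < j) : coSiegel K n j = ⊥ := by
  rw [eq_bot_iff]
  intro θ hθ
  have := coSiegel_le_Hom K j hθ
  rw [Hom_univ_eq_bot_of_lt K hj] at this
  exact this

/-! ## §100. `k` pure classes never cut out `SI_k`: G3 is sharp -/

/-- **G3 IS SHARP: `SI_k < ⋂_{i<r} Kr(univ, w_n(A_i λ_i^•), k)` for `0 < r ≤ k ≤ n` pure classes** (any slopes, `A_i ≠ 0`): the intersection is `Ann_k` of the sum of `r` pure images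
of dimension `C(n,k)` each (`k + k′ = n`), so its codimension in `⋀^k` is at most `r·C(n,k) < (k+1)·C(n,k) = codim SI_k`. -/
theorem siegelIdeal_lt_iInf_Kr_w_exp {k r : ℕ} (hk : k ≤ n) (hr : 0 < r) (hrk : r ≤ k) (lam : Fin r → K) {A : Fin r → K} (hA : ∀ i, A i ≠ 0) :
    siegelIdeal K n k < ⨅ i, Kr K Finset.univ (w K n n (fun j => A i * lam i ^ j)) k := by
  classical
  refine lt_of_le_of_ne (le_iInf fun i => siegelIdeal_le_Kr_w K n k _) fun heq => ?_
  have hkk' : k + (n - k) = n := by omega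
  set W := ⨆ i, V K (In n) Finset.univ (w K n n (fun j => A i * lam i ^ j)) (n - k) with hW
  have hAnn : Ann K k W = ⨅ i, Kr K Finset.univ (w K n n (fun j => A i * lam i ^ j)) k := Ann_iSup_V_w_eq_iInf_Kr K hkk' hr _
  have hWle : W ≤ Hom K (In n) Finset.univ (n - k + n) := iSup_le fun i => (V_w_le_coSiegel K hkk' _).trans (coSiegel_le_Hom K _)
  -- dim W ≤ r · C(n,k)
  have hfs : ∀ s : Finset (Fin r), finrank K ↥(s.sup fun i => V K (In n) Finset.univ (w K n n (fun j => A i * lam i ^ j)) (n - k)) ≤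
      ∑ i ∈ s, finrank K (V K (In n) Finset.univ (w K n n (fun j => A i * lam i ^ j)) (n - k)) := by
    intro s
    induction s using Finset.induction_on with
    | empty => rw [Finset.sup_empty, finrank_bot, Finset.sum_empty]
    | insert a s ha ih =>
      rw [Finset.sup_insert, Finset.sum_insert ha]
      exact (Submodule.finrank_add_le_finrank_add_finrank _ _).trans (Nat.add_le_add_left ih _)
  have hdimW : finrank K W ≤ r * n.choose k := by
    have h := hfs Finset.univ
    rw [Finset.sup_univ_eq_iSup, Finset.sum_congr rfl fun i _ => finrank_V_w_exp K hkk' (lam i) (hA i), Finset.sum_const, Finset.card_univ,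
      Fintype.card_fin, smul_eq_mul] at h
    exact h
  have h1 := finrank_Ann_add K (a := k) (b := n - k + n) (I := In n) (by rw [Fintype.card_fin]; omega) hWle
  rw [hAnn, ← heq, Fintype.card_fin] at h1
  have h2 := finrank_siegelIdeal K (n := n) k
  have hpos : 0 < n.choose k := Nat.choose_pos hk
  have : (k + 1) * n.choose k ≤ r * n.choose k := by omega
  have := Nat.le_of_mul_le_mul_right this hpos
  omega

end Summit.Ventures.HSemireg.Wedge.KernelDuality
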